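import Literature.AnabelianGeometry.EtaleTheta.ThetaCohomologySaturated
import Literature.AnabelianGeometry.EtaleTheta.Discharge.Sec2ThetaOrbitClasses
import Literature.AnabelianGeometry.EtaleTheta.BarDeltaOfSetting
import HarnessLib

/-!
# [EtTh] Prop. 1.5 (ii)–(iii) over the §1 setting: `log(Ü) ∉ F̈²` — the Kummer class of `Ü` does NOT
# die on the geometric subgroup `(Δ^tp_Ÿ)^Θ` — DERIVED from the named §1 facts (GAP-LEDGER G-L2t1-1)

Mochizuki, *The étale theta function and its Frobenioid-theoretic manifestations*, Publ. RIMS **45**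
(2009), §1, PRIMS PDF p. 12 ("`Δ^Θ_X := Δ_X/[Δ_X,[Δ_X,Δ_X]]`", "`(Ẑ(1) ≅) Δ_Θ`", "`Δ^tp_X/Δ^tp_Y ≅ Z`"),
Prop. 1.5 (ii) p. 23 ("`F̈¹/F̈² = Hom((Δ^tp_Ÿ)^ell/Δ_Θ, Δ_Θ) = Ẑ · log(Ü)`"), Prop. 1.5 (iii) p. 23 ("maps
to `log(Θ)` in the quotient `F̈⁰/F̈¹` and on which `a ∈ Z` acts as
`η̈^Θ ↦ η̈^Θ − 2a · log(Ü) − (a²/2) · log(q_X) + log(O^×_K̈)`") [cite: MochizukiEtTh2009, Prop 1.5 (iii) p.23].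

Cell abc-iut, layer L2 (seat abc-iut-L2-t7); GAP-LEDGER row G-L2t1-1 = the hypothesis binder `hL`
("`log(Ü)` has infinite order modulo `F̈²`") of seat abc-iut-L2-t1's `Sec1TranslatesNonTorsion`.
PROOF-ONLY (0 definitions). The census entry "not derivable over the typed §1 interface (meta-model
`log(U) = log(Ü) = 1`)" is correct for `KummerData` + `Prop15ii` ALONE; this file shows that JOINTLY
with `Prop15iii` and the vacuity guard `IsEtThOrigin` the clause IS a theorem:

* GROUP THEORY (`exists_commutator_toTheta_ne_one`): under `IsEtThOrigin`, some commutator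
  `[s, g]`, `s ∈ Δ^tp_X`, `g ∈ Δ^tp_Ÿ`, survives in `(Π^tp_X)^Θ`. Otherwise `(Δ^tp_Y)^Θ` is central in
  the class-two group `(Δ^tp_X)^Θ` (`y² ∈ Δ^tp_Ÿ` for `y ∈ Δ^tp_Y` and `[s, y²] = [s, y]²`, `Δ_Θ`
  torsion-free), so `(Δ^tp_X)^Θ = ⟨(Δ^tp_Y)^Θ, s₀⟩` (`Δ^tp_X ↠ Z`) is abelian, so by density of
  `Δ^tp_X` in `Δ_X` (definition of `DeltaHat`) `[Δ_X, Δ_X]⁻ ⊆ [[Δ_X, Δ_X], Δ_X]⁻`, i.e. `Δ_Θ = 1` —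
  contradicting `IsEtThOrigin.deltaTheta_ne_bot`.
* COHOMOLOGY (`EtaleThetaData.logUdd_not_mem_Fdd2`): if `log(Ü) ∈ F̈² = Ker(res → H¹((Δ^tp_Ÿ)^Θ, Δ_Θ))`
  (`∋` the Kummer classes, `Prop15ii`), restrict the `Z`-action formula of `Prop15iii` for a GEOMETRIC
  `σ ∈ Δ^tp_X` to `(Δ^tp_Ÿ)^Θ`: all three factors die, so the lift `x'` of `η̈^Θ` restricts to a
  `σ`-invariant HOMOMORPHISM `f` on `(Δ^tp_Ÿ)^Θ` (which centralises `Δ_Θ`), whence `f([s, g]) = 1`;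
  but `[s, g] ∈ Δ_Θ` and `f|_{Δ_Θ} = id` (the normalisation "maps to `log(Θ)`"), so `[s, g] = 1` for
  all `s, g` — contradicting the group theory.
* `EtaleThetaData.logUdd_zpow_mem_Fdd2_imp` — **the binder `hL` in EXACTLY its typed shape, from
  `Compat`, `IsEtThOrigin`, `Prop15iii`, `Prop15ii`** (no `K = K̈`, no new field), via the root-closedness
  of `F̈²` (`ThetaCohomologySaturated`).

At the root model `ThetaSetting.model p` all of this is vacuous (`KummerData` is empty there, seat
abc-iut-w5-d171's `model_isEmpty_kummerData`); the derivation is generic. Nothing of [EtTh] is asserted;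
typed ≠ endorsed; no side is taken on any disputed claim.
-/

noncomputable section

namespace Literature.AnabelianGeometry.EtaleTheta

open Literature.AnabelianGeometry.SemiGraphs
open scoped IsMulCommutative

namespace ThetaSetting

variable {p : ℕ} [Fact p.Prime] {D : ThetaSetting p}

/-! ## Group theory of the class-two quotient `(Δ^tp_X)^Θ` -/

/-- `y ∈ Δ^tp_Y ⇒ y² ∈ Δ^tp_Ÿ = Δ^tp_{Y₂}` ("`Δ^tp_Y/Δ^tp_{Y_N} ≅ ℤ/Nℤ(1)`" at `N = 2`, p. 16: the root
field `relIndex_deltaYN`). [cite: MochizukiEtTh2009, §1 p.13] -/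
theorem mul_self_mem_DtpYddN_one {y : D.PiTemp} (hy : y ∈ D.DtpY) : y * y ∈ D.DtpYddN 1 := by
  have hy' : y ∈ D.toZ.ker ⊓ D.aug.toMonoidHom.ker := hy
  have h2 : ((D.GtpYN 2 ⊓ D.aug.toMonoidHom.ker).subgroupOf
      (D.toZ.ker ⊓ D.aug.toMonoidHom.ker)).index = 2 := D.relIndex_deltaYN 2
  have hmem := Subgroup.mul_self_mem_of_index_two h2 ⟨y, hy'⟩
  rw [Subgroup.mem_subgroupOf] at hmem
  have hmem' : y * y ∈ D.GtpYN 2 ⊓ D.aug.toMonoidHom.ker := hmem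
  have h1 : D.aug.toMonoidHom (y * y) = 1 := (MonoidHom.mem_ker).mp hmem'.2
  change y * y ∈ (D.GtpYN (2 * 1) ⊓ (D.GJddN 1).comap D.aug.toMonoidHom) ⊓ D.DeltaTemp
  refine Subgroup.mem_inf.mpr ⟨Subgroup.mem_inf.mpr ⟨?_, ?_⟩, hmem'.2⟩
  · rw [mul_one]; exact hmem'.1
  · rw [Subgroup.mem_comap, h1]; exact one_mem _

/-- In the class-two group `(Δ^tp_X)^Θ` (`Δ_Θ` central, commutators in `Δ_Θ`, `Δ_Θ` torsion-free
under the guard): if `[s, g]` dies for every `g ∈ Δ^tp_Ÿ`, then `[s, y]` dies for every `y ∈ Δ^tp_Y`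
(`[s, y²] = [s, y]²`). [cite: MochizukiEtTh2009, §1 p.12] -/
theorem toTheta_comm_of_dtpY (hO : D.IsEtThOrigin)
    (H0 : ∀ s ∈ D.DeltaTemp, ∀ g ∈ D.DtpYddN 1, D.toTheta (s * g * s⁻¹ * g⁻¹) = 1)
    {s y : D.PiTemp} (hs : s ∈ D.DeltaTemp) (hy : y ∈ D.DtpY) :
    D.toTheta s * D.toTheta y = D.toTheta y * D.toTheta s := by
  set a := D.toTheta s with ha
  set b := D.toTheta y with hb
  have haΔ : a ∈ D.DtpTheta := ⟨s, hs, rfl⟩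
  have hbΔ : b ∈ D.DtpTheta := ⟨y, hy.2, rfl⟩
  set c := a * b * a⁻¹ * b⁻¹ with hc
  have hcΘ : c ∈ D.DeltaTheta := D.commutator_mem_deltaTheta haΔ hbΔ
  have hbc : b * c = c * b := (D.deltaTheta_comm_dtpTheta hcΘ hbΔ).symm
  have h1 : a * (b * b) * a⁻¹ * (b * b)⁻¹ = 1 := by
    have := H0 s hs (y * y) (mul_self_mem_DtpYddN_one hy)
    simpa only [map_mul, map_inv] using this
  have e1 : a * b * a⁻¹ = c * b := by rw [hc]; group
  have e2 : a * (b * b) * a⁻¹ * (b * b)⁻¹ = c * c := by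
    calc a * (b * b) * a⁻¹ * (b * b)⁻¹
        = (a * b * a⁻¹) * (a * b * a⁻¹) * b⁻¹ * b⁻¹ := by group
      _ = (c * b) * (c * b) * b⁻¹ * b⁻¹ := by rw [e1]
      _ = c * (b * c) * b⁻¹ := by group
      _ = c * (c * b) * b⁻¹ := by rw [hbc]
      _ = c * c := by group
  have hc1 : c = 1 := D.deltaTheta_eq_one_of_sq_eq_one hO hcΘ (by rw [sq, ← e2, h1])
  calc a * b = (a * b * a⁻¹ * b⁻¹) * b * a := by group
    _ = b * a := by rw [← hc, hc1, one_mul]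

/-- … and then `(Δ^tp_X)^Θ = ⟨(Δ^tp_Y)^Θ, s₀⟩` (`Δ^tp_X ↠ Z`, root field `toZ_delta_surjective`) is
ABELIAN. [cite: MochizukiEtTh2009, §1 p.12] -/
theorem toTheta_comm_of_deltaTemp (hO : D.IsEtThOrigin)
    (H0 : ∀ s ∈ D.DeltaTemp, ∀ g ∈ D.DtpYddN 1, D.toTheta (s * g * s⁻¹ * g⁻¹) = 1)
    {s t : D.PiTemp} (hs : s ∈ D.DeltaTemp) (ht : t ∈ D.DeltaTemp) :
    D.toTheta s * D.toTheta t = D.toTheta t * D.toTheta s := by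
  obtain ⟨⟨s₀, hs₀⟩, hZ⟩ := D.toZ_delta_surjective (Multiplicative.ofAdd 1)
  rw [MonoidHom.restrict_apply] at hZ
  -- every geometric element is `y · s₀ⁿ` with `y ∈ Δ^tp_Y`
  have decomp : ∀ u ∈ D.DeltaTemp, ∃ y ∈ D.DtpY, ∃ n : ℤ, u = y * s₀ ^ n := by
    intro u hu
    refine ⟨u * (s₀ ^ Multiplicative.toAdd (D.toZ u))⁻¹, ⟨?_, ?_⟩, Multiplicative.toAdd (D.toZ u),
      by rw [inv_mul_cancel_right]⟩
    · change D.toZ (u * (s₀ ^ Multiplicative.toAdd (D.toZ u))⁻¹) = 1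
      rw [map_mul, map_inv, map_zpow, hZ, ← ofAdd_zsmul, smul_eq_mul, mul_one, ofAdd_toAdd,
        mul_inv_cancel]
    · have hs₀' : s₀ ∈ D.DeltaTemp := hs₀
      exact D.DeltaTemp.mul_mem hu (D.DeltaTemp.inv_mem (D.DeltaTemp.zpow_mem hs₀' _))
  have hS : ∀ y ∈ D.DtpY, Commute (D.toTheta y) (D.toTheta s₀) := fun y hy =>
    (toTheta_comm_of_dtpY hO H0 hs₀ hy).symm
  have hY : ∀ y ∈ D.DtpY, ∀ y' ∈ D.DtpY, Commute (D.toTheta y) (D.toTheta y') := fun y hy y' hy' =>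
    (toTheta_comm_of_dtpY hO H0 hy'.2 hy).symm
  obtain ⟨y, hy, n, rfl⟩ := decomp s hs
  obtain ⟨y', hy', m, rfl⟩ := decomp t ht
  rw [map_mul, map_mul, map_zpow, map_zpow]
  exact (((hY y hy y' hy').mul_right ((hS y hy).zpow_right m)).mul_left
    (((hS y' hy').zpow_right n).symm.mul_right ((Commute.refl _).zpow_zpow n m))).eq

/-- **The geometric non-commutativity of the theta quotient.** Under the vacuity guard `IsEtThOrigin`
(`Δ_Θ ≠ 1` torsion-free), some commutator `[s, g]` with `s ∈ Δ^tp_X`, `g ∈ Δ^tp_Ÿ` survives in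
`(Π^tp_X)^Θ` ("`Δ^Θ_X`" is a NON-abelian central extension: "`Δ_Θ`, the image of `∧² Δ^ell_X`", p. 12).
Proof: otherwise `(Δ^tp_X)^Θ` is abelian (`toTheta_comm_of_deltaTemp`), so `[Δ^tp_X, Δ^tp_X]` maps into
`[[Δ_X,Δ_X],Δ_X]⁻` (root field `ker_toTheta`); `Δ_X` is the CLOSURE of the image of `Δ^tp_X`
(definition of `DeltaHat`), so `[Δ_X, Δ_X]⁻ ⊆ [[Δ_X,Δ_X],Δ_X]⁻`, i.e. `Ker(↠ ell) ⊆ Ker(↠ Θ)` (root field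
`ker_toEll`) and `Δ_Θ = 1`. [cite: MochizukiEtTh2009, §1 p.12] -/
theorem exists_commutator_toTheta_ne_one (hO : D.IsEtThOrigin) :
    ∃ s ∈ D.DeltaTemp, ∃ g ∈ D.DtpYddN 1, D.toTheta (s * g * s⁻¹ * g⁻¹) ≠ 1 := by
  by_contra H
  push Not at H
  have hab : ∀ s ∈ D.DeltaTemp, ∀ t ∈ D.DeltaTemp, s * t * s⁻¹ * t⁻¹ ∈ D.toTheta.ker := by
    intro s hs t ht
    rw [MonoidHom.mem_ker, map_mul, map_mul, map_mul, map_inv, map_inv,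
      toTheta_comm_of_deltaTemp hO H hs ht, mul_inv_cancel_right, mul_inv_cancel]
  -- the closed subgroup `[[Δ_X,Δ_X],Δ_X]⁻` contains all commutators of `Δ_X`, by density
  set Γ : Subgroup D.PiHat := (⁅⁅D.DeltaHat, D.DeltaHat⁆, D.DeltaHat⁆).topologicalClosure with hΓ
  have hΓcl : IsClosed (Γ : Set D.PiHat) := Subgroup.isClosed_topologicalClosure _
  set M : Set D.PiHat := (D.DeltaTemp.map D.toHat.toMonoidHom : Set D.PiHat) with hM
  have hS : IsClosed {q : D.PiHat × D.PiHat | q.1 * q.2 * q.1⁻¹ * q.2⁻¹ ∈ (Γ : Set D.PiHat)} :=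
    hΓcl.preimage (by fun_prop)
  have hMM : M ×ˢ M ⊆ {q : D.PiHat × D.PiHat | q.1 * q.2 * q.1⁻¹ * q.2⁻¹ ∈ (Γ : Set D.PiHat)} := by
    rintro ⟨a, b⟩ ⟨⟨s, hs, rfl⟩, ⟨t, ht, rfl⟩⟩
    have h := hab s hs t ht
    rw [D.ker_toTheta, Subgroup.mem_comap, map_mul, map_mul, map_mul, map_inv, map_inv] at h
    exact h
  have hcl : closure M ×ˢ closure M ⊆
      {q : D.PiHat × D.PiHat | q.1 * q.2 * q.1⁻¹ * q.2⁻¹ ∈ (Γ : Set D.PiHat)} := by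
    rw [← closure_prod_eq]; exact hS.closure_subset_iff.mpr hMM
  have hΔcl : (D.DeltaHat : Set D.PiHat) = closure M := by
    change (((D.DeltaTemp.map D.toHat.toMonoidHom).topologicalClosure : Subgroup D.PiHat) :
      Set D.PiHat) = closure M
    rw [Subgroup.topologicalClosure_coe]
  have hcomm : ⁅D.DeltaHat, D.DeltaHat⁆ ≤ Γ := by
    rw [Subgroup.commutator_le]
    intro a ha b hb
    rw [commutatorElement_def]
    have ha' : a ∈ closure M := by rw [← hΔcl]; exact ha
    have hb' : b ∈ closure M := by rw [← hΔcl]; exact hb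
    exact hcl (Set.mk_mem_prod ha' hb')
  have hle : (⁅D.DeltaHat, D.DeltaHat⁆).topologicalClosure ≤ Γ :=
    Subgroup.topologicalClosure_minimal _ hcomm hΓcl
  have hker : (D.thetaToEll.comp D.toTheta).ker ≤ D.toTheta.ker := by
    rw [D.ker_toEll, D.ker_toTheta]
    exact Subgroup.comap_mono hle
  refine hO.deltaTheta_ne_bot ((Subgroup.eq_bot_iff_forall _).mpr fun z hz => ?_)
  obtain ⟨t, rfl⟩ := D.toTheta_surjective z
  have ht : t ∈ (D.thetaToEll.comp D.toTheta).ker := hz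
  exact hker ht

/-! ## Cohomology: `log(Ü)` does not die on `(Δ^tp_Ÿ)^Θ` -/

namespace EtaleThetaData

variable {E : D.EtaleThetaData}

/-- **`log(Ü) ∉ F̈²`** — the Kummer class of `Ü` restricts NON-trivially to the geometric subgroup
`(Δ^tp_Ÿ)^Θ` (the typeable half of "`F̈¹/F̈² = Hom((Δ^tp_Ÿ)^ell/Δ_Θ, Δ_Θ) = Ẑ · log(Ü)`", Prop. 1.5 (ii),
p. 23) — DERIVED from `Compat`, the vacuity guard `IsEtThOrigin`, `Prop15iii` (the `Z`-action formula with
its normalisation "maps to `log(Θ)`") and `Prop15ii` (`F̈² ⊇` the Kummer classes). If `log(Ü)` died on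
`(Δ^tp_Ÿ)^Θ`, the lift `x'` of `η̈^Θ` would restrict to a homomorphism on `(Δ^tp_Ÿ)^Θ` invariant under
every GEOMETRIC `σ ∈ Δ^tp_X`, killing the commutators `[σ, Δ^tp_Ÿ] ⊆ Δ_Θ` on which it is the identity —
so all of them vanish, against `exists_commutator_toTheta_ne_one`. [cite: MochizukiEtTh2009, Prop 1.5 (iii) p.23] -/
theorem logUdd_not_mem_Fdd2 (hC : D.Compat) (hO : D.IsEtThOrigin) (h15 : Prop15iii E hC)
    (h15ii : Prop15ii E.toKummerData hC) :
    E.logUdd ∉ (Fdd2 : Subgroup (D.H1Theta (D.GtpYdd.map D.toTheta))) := by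
  intro hL
  haveI := hC.GtpYddTheta_normal
  haveI := hC.DtpYddTheta_normal
  obtain ⟨s, hs, g, hg, hne⟩ := exists_commutator_toTheta_ne_one (D := D) hO
  apply hne
  -- the lift `x'` of `η̈^Θ` with its normalisation and `Z`-action formula (Prop. 1.5 (iii))
  obtain ⟨x', ⟨-, hnorm, hΦ⟩, -⟩ := h15 E.etaDd E.etaDd_mem_thetaClasses
  have hM : (D.DtpYddN 1).map D.toTheta ≤ D.GtpYdd.map D.toTheta := Subgroup.map_mono inf_le_left
  have hMΔ : (D.DtpYddN 1).map D.toTheta ≤ D.DtpTheta := Subgroup.map_mono inf_le_right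
  have hΘM : D.DeltaTheta ≤ (D.DtpYddN 1).map D.toTheta := hC.deltaTheta_le_DtpYddTheta
  -- restriction to `(Δ^tp_Ÿ)^Θ` kills `F̈²`, in particular the Kummer classes and (assumption) `log(Ü)`
  have hres1 : ∀ z ∈ (Fdd2 : Subgroup (D.H1Theta (D.GtpYdd.map D.toTheta))),
      ContH1.res (MonoidHom.id D.GtpTheta) D.DeltaTheta hM z = 1 := fun z hz => hz
  have hkum : ∀ w, ContH1.res (MonoidHom.id D.GtpTheta) D.DeltaTheta hM (E.kumYdd w) = 1 := fun w =>
    hres1 _ (by rw [h15ii.Fdd2_eq]; exact ⟨w, rfl⟩)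
  -- invariance of `res x'` under the geometric element `s⁻¹`
  obtain ⟨u, -, hσ⟩ := hΦ s⁻¹
  have hinv : ContH1.conj (MonoidHom.id D.GtpTheta) D.DeltaTheta (D.toTheta s⁻¹)
      (ContH1.res (MonoidHom.id D.GtpTheta) D.DeltaTheta hM x') =
      ContH1.res (MonoidHom.id D.GtpTheta) D.DeltaTheta hM x' := by
    rw [← ContH1.res_conj hM, hσ, map_mul, map_mul, map_mul, map_zpow, map_zpow, hres1 _ hL, hkum,
      hkum, one_zpow, one_zpow, mul_one, mul_one, mul_one]
  -- a representing cocycle `f` of `res x'`: a continuous HOMOMORPHISM on `(Δ^tp_Ÿ)^Θ`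
  obtain ⟨f, hf⟩ := QuotientGroup.mk_surjective (ContH1.res (MonoidHom.id D.GtpTheta) D.DeltaTheta hM x')
  -- trivial actions: `(Δ^tp_Ÿ)^Θ` and the geometric `s` centralise `Δ_Θ`
  have htrivM : ∀ (k : (D.DtpYddN 1).map D.toTheta) (a : D.DeltaTheta),
      MulAut.conjNormal ((MonoidHom.id D.GtpTheta) (k : D.GtpTheta)) a = a := fun k a =>
    Subtype.ext (by
      rw [MulAut.conjNormal_apply, MonoidHom.id_apply, ← D.deltaTheta_comm_dtpTheta a.2 (hMΔ k.2),
        mul_inv_cancel_right])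
  have hsΔ : D.toTheta s⁻¹ ∈ D.DtpTheta := ⟨s⁻¹, inv_mem hs, rfl⟩
  have htrivS : ∀ a : D.DeltaTheta,
      MulAut.conjNormal ((MonoidHom.id D.GtpTheta) (D.toTheta s⁻¹)) a = a := fun a =>
    Subtype.ext (by
      rw [MulAut.conjNormal_apply, MonoidHom.id_apply, ← D.deltaTheta_comm_dtpTheta a.2 hsΔ,
        mul_inv_cancel_right])
  have hmul : ∀ k k' : (D.DtpYddN 1).map D.toTheta, f.1 (k * k') = f.1 k * f.1 k' := fun k k' => by
    rw [f.2.2 k k', htrivM]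
  -- `f` is `s`-invariant as a FUNCTION: `f(k) = f(s k s⁻¹)`
  rw [← hf, ContH1.conj_mk] at hinv
  obtain ⟨a, ha⟩ := ContH1.exists_coboundary_of_mk_eq _ _ hinv
  have hfix : ∀ k : (D.DtpYddN 1).map D.toTheta,
      f.1 k = f.1 (MulAut.conjNormal (D.toTheta s⁻¹)⁻¹ k) := fun k => by
    rw [ha k, htrivM, mul_inv_cancel, mul_one, ContH1.conjCocycle_apply, htrivS]
  -- `f` is the identity on `Δ_Θ` (normalisation `res_{Δ_Θ} x' = log(Θ)`)
  have hn2 : ContH1.res (MonoidHom.id D.GtpTheta) D.DeltaTheta hΘM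
      (ContH1.res (MonoidHom.id D.GtpTheta) D.DeltaTheta hM x') = D.logTheta := by
    rw [ContH1.res_res]; exact hnorm
  rw [← hf] at hn2
  obtain ⟨a', ha'⟩ := ContH1.exists_coboundary_of_mk_eq _ _ hn2
  have hid : ∀ v : D.DeltaTheta, f.1 ⟨v.1, hΘM v.2⟩ = v := fun v => by
    have h := ha' v
    have htv : MulAut.conjNormal ((MonoidHom.id D.GtpTheta) (v : D.GtpTheta)) a' = a' :=
      Subtype.ext (by
        rw [MulAut.conjNormal_apply, MonoidHom.id_apply, D.ker_thetaToEll_comm _ v.2 _ a'.2,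
          mul_inv_cancel_right])
    rw [htv, mul_inv_cancel, mul_one] at h
    exact h.symm
  -- the commutator `c = s g s⁻¹ g⁻¹` as an element of `(Δ^tp_Ÿ)^Θ`, and of `Δ_Θ`
  set gM : (D.DtpYddN 1).map D.toTheta := ⟨D.toTheta g, g, hg, rfl⟩ with hgM
  set cM : (D.DtpYddN 1).map D.toTheta := MulAut.conjNormal (D.toTheta s⁻¹)⁻¹ gM * gM⁻¹ with hcM
  have hcval : (cM : D.GtpTheta) = D.toTheta (s * g * s⁻¹ * g⁻¹) := by
    simp only [hcM, hgM, Subgroup.coe_mul, Subgroup.coe_inv, MulAut.conjNormal_apply, map_inv, inv_inv,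
      map_mul]
  have hcΘ : (cM : D.GtpTheta) ∈ D.DeltaTheta := by
    rw [hcval, map_mul, map_mul, map_mul, map_inv, map_inv]
    exact D.commutator_mem_deltaTheta ⟨s, hs, rfl⟩ ⟨g, hg.2, rfl⟩
  -- `f(c) = 1` by invariance and multiplicativity …
  have hfc1 : f.1 cM = 1 := by
    have h := hfix gM
    rw [show MulAut.conjNormal (D.toTheta s⁻¹)⁻¹ gM = cM * gM by rw [hcM, inv_mul_cancel_right],
      hmul] at h
    have h' : 1 * f.1 gM = f.1 cM * f.1 gM := by rwa [one_mul]
    exact (mul_right_cancel h').symm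
  -- … and `f(c) = c` by the normalisation: so `c = 1`
  have hfc2 : ((f.1 cM : D.DeltaTheta) : D.GtpTheta) = (cM : D.GtpTheta) := by
    have h := hid ⟨cM, hcΘ⟩
    have e : (⟨(⟨(cM : D.GtpTheta), hcΘ⟩ : D.DeltaTheta).1, hΘM hcΘ⟩ : (D.DtpYddN 1).map D.toTheta) = cM :=
      Subtype.ext rfl
    rw [e] at h
    rw [h]
  rw [← hcval, ← hfc2, hfc1]
  rfl

/-- **GAP-LEDGER G-L2t1-1 DERIVED — the binder `hL` of `Sec1TranslatesNonTorsion` in exactly its typed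
shape**: "`log(Ü)` has infinite order modulo `F̈²`", from `Compat`, `IsEtThOrigin`, `Prop15iii`,
`Prop15ii` (no `K = K̈`, no new interface field): `log(Ü) ∉ F̈²` (`logUdd_not_mem_Fdd2`) and `F̈²` is
root-closed (`ThetaCohomologySaturated`). [cite: MochizukiEtTh2009, Prop 1.5 (ii) p.23] -/
theorem logUdd_zpow_mem_Fdd2_imp (hC : D.Compat) (hO : D.IsEtThOrigin) (h15 : Prop15iii E hC)
    (h15ii : Prop15ii E.toKummerData hC) :
    ∀ n : ℤ, E.logUdd ^ n ∈ (Fdd2 : Subgroup (D.H1Theta (D.GtpYdd.map D.toTheta))) → n = 0 :=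
  E.toKummerData.logUdd_zpow_mem_Fdd2_imp_of_not_mem hO (logUdd_not_mem_Fdd2 hC hO h15 h15ii)

end EtaleThetaData

end ThetaSetting

end Literature.AnabelianGeometry.EtaleTheta

end
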